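import Summits.CriticalPhenomena.PercolationContinuityZ3.Theorems.PercNearOneGluingNoHeavyLowerTailSunflowerC1SplittingCertificate
import HarnessLib

/-!
# `NoHeavyLowerTail` (crux stmt-CriticalPhenomena-4575), abstract sunflower cubic at LAW level: the RECURSIVE GLADKOV SPLITTING —
# a canonical, intrinsic sandwich certificate generator for (C1), one `native_decide` per structure

Support file (seat `prim-ineq-gen-2` gen 34; `--supports stmt-CriticalPhenomena-4575`).  No `sorry`, no named facts, standard axioms.  As in
…SunflowerC1SplittingCertificate the functions below only PROPOSE a certificate; soundness is entirely `C1Cert.c1_of_certs`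
(…SunflowerC1RegionCertificate), which re-verifies the proposed tables.  Memo: run/shared/lean/prim/prim-ineq-gen-2/RECURSIVE-SPLITTING-GEN34.md §3.

THE RECURSIVE RULE (memo §3).  A SANDWICH splitting is `y : {2-fibres β} → [0,1]` with `LA − (a−b)·S ≽ 0` (scaled tensor-Bernstein) for
`S = Σ_β y_β g(β) x^β(1−x)^{2−β}`, `g` = Bernstein coefficients of `AG = ab − e₂(c)`; then also `LB − (b−a)(AG − S) ≽ 0`, so (C1) holds on both sides.
Every 3-fibre `α` with rainbow count `r(α) > 0` is a TOP ROW of exactly one interval sub-cube `Q = [S,T]` (`S = {α = 3}`, `T = {α ≠ 0}`), its row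
constraint involves only sub-cubes of `Q`, and `y(Q)` itself only through the row's upper point `{α ≥ 2}` (an upper bound if that point is in the
core, a lower bound if it is in the bottom cell).  So `y` can be DEFINED by recursion on `dim Q`: given `y` on the proper sub-cubes, the top rows of `Q`
leave an interval `[L_Q, U_Q]` for `y(Q)`; take its midpoint (clipped to `[0,1]`).  The resulting `y(Q)` depends only on the restriction of the
structure to `Q` (an intrinsic rule).  CENSUS (gen 34, exact): this never meets an empty interval and always yields a valid sandwich — all 146 / 737
three-petal classes on 4 / 5 coins, 3 000 + 800 + 300 + 40 random structures on 6/7/8/9 coins, the cyclic star CS(3,3,3), the doubled star, the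
twelve percolation structures of gen 33 (where the gen-33 majority rule fails on four) and all duals: 6 276 / 6 276 (kit j238821–j238823).
* `maskSet`, `labCode` — points as bit masks, the label table of `F`;  `e3Arr`, `rBern` — table and Bernstein coefficients (= rainbow counts) of `e₃`;
* `recWeights F : Array ℚ` — the recursive midpoint weights `y(Q)` indexed by the base-3 code of `β_Q`;
* `recTables F : ℕ × Array ℤ × Array ℤ` — common denominator `N` and the monomial tables of `N·S`, `N·(AG − S)`;
* `checkRec F : Bool` — the two `certSide` checks;  **`c1_of_checkRec`**: `checkRec F = true ⟹` (C1) for `F` at every bias;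
* `RecursiveSplittingConjecture : Prop` — `∀ n F, checkRec F = true` (census-true; OPEN), and `c1_of_recursiveSplittingConjecture`.
Usage: `theorem foo : checkRec F = true := by native_decide` (proposed `--computational`), then `c1_of_checkRec F foo`.
-/

namespace Summit.CriticalPhenomena.PercolationContinuityZ3.Theorems.SunflowerPartition

namespace SafeCalc

namespace C1Cert

open Finset Bern

variable {n : ℕ}

/-! ## Points as bit masks, digit codes -/

/-- The subset of `Fin n` coded by the bit mask `m`. [this work] -/
def maskSet (n m : ℕ) : Finset (Fin n) := univ.filter fun i => m.testBit (i : ℕ)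

/-- The label table of `F` (index = bit mask of the point; `0` bottom, `1,2,3` petals, `4` core). [this work] -/
def labCode (F : Sunflower (Fin n)) : Array ℕ := (Array.range (2 ^ n)).map fun m => ((F.lab (maskSet n m) : Fin 5) : ℕ)

/-- Mixed-radix code `Σ_i dig(i)·b^i` of a digit function (matches `Bern.encode`: coordinate `0` least significant). [this work] -/
def codeOf (n b : ℕ) (dig : ℕ → ℕ) : ℕ := (List.range n).foldr (fun i acc => dig i + b * acc) 0

/-- The `i`-th base-`b` digit of a code. [this work] -/
def digitOf (b c i : ℕ) : ℕ := (c / b ^ i) % b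

/-- Number of base-3 digits of `c` (among the first `n`) equal to `1` (= dimension of the sub-cube coded by `c`). [this work] -/
def dim3 (n c : ℕ) : ℕ := ((List.range n).filter fun i => digitOf 3 c i == 1).length

/-- Bit mask of the coordinates whose base-3 digit of `c` equals `v`. [this work] -/
def maskOfDigit (n c v : ℕ) : ℕ := (List.range n).foldr (fun i acc => if digitOf 3 c i == v then acc + 2 ^ i else acc) 0

/-- All sub-masks of the bit mask `D` (as a list; `n` coins). [this work] -/
def subMasks (n D : ℕ) : List ℕ := (List.range (2 ^ n)).filter fun W => W &&& D == W

/-! ## Rainbow counts -/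

/-- TABLE of `e₃ = c₁c₂c₃` (degree `3`). [this work] -/
def e3Arr (F : Sunflower (Fin n)) : Array ℤ := prod3 (n := n) (cellA F 1) (cellA F 2) (cellA F 3)

/-- Scaled tensor-Bernstein coefficients of `e₃` = the RAINBOW COUNTS `r(α)` (ordered triples `(c₁,c₂,c₃) ∈ C₁×C₂×C₃` with `c₁+c₂+c₃ = α`). [this work] -/
def rBern (F : Sunflower (Fin n)) : Array ℤ := bernCoeffsA n 3 (e3Arr F)

/-! ## The recursion -/

/-- Base-3 code of the fibre `α − x` for the top row `V` of the sub-cube `(S,D)` and the point `x = S ∪ W` (`W ⊆ D`):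
digit `2` on `S ∪ (V∖W)`, `1` on `(V∩W) ∪ ((D∖V)∖W)`, `0` elsewhere. [this work] -/
def subCode (n S D V W : ℕ) : ℕ :=
  codeOf n 3 fun i =>
    if S.testBit i then 2
    else if D.testBit i then
      (if V.testBit i then (if W.testBit i then 1 else 2) else (if W.testBit i then 0 else 1))
    else 0

/-- Base-4 code of the top row `V` of the sub-cube `(S,D)`: digit `3` on `S`, `2` on `V`, `1` on `D∖V`, `0` elsewhere. [this work] -/
def rowCode (n S D V : ℕ) : ℕ :=
  codeOf n 4 fun i => if S.testBit i then 3 else if D.testBit i then (if V.testBit i then 2 else 1) else 0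

/-- One step of the recursion: the weight of the sub-cube with base-3 code `c`, given the weights `y` of its proper sub-cubes
(midpoint of the interval its top rows leave; clipped to `[0,1]`; if the interval is empty the lower end is returned and the final
check will fail). [this work] -/
def recStep (n : ℕ) (lab : Array ℕ) (g r : Array ℤ) (y : Array ℚ) (c : ℕ) : ℚ :=
  let S := maskOfDigit n c 2
  let D := maskOfDigit n c 1
  let gQ : ℤ := g.getD c 0
  if gQ ≤ 0 then 0 else
  let subs := subMasks n D
  -- fold over the top rows V ⊆ D, accumulating (lower bound, upper bound) as options
  let bounds : Option ℚ × Option ℚ :=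
    subs.foldl (fun (LU : Option ℚ × Option ℚ) V =>
      let rV : ℤ := r.getD (rowCode n S D V) 0
      if rV ≤ 0 then LU else
      -- sum the contributions of the proper sub-cubes and find the own coefficient
      let acc : ℚ × ℤ :=
        subs.foldl (fun (tc : ℚ × ℤ) W =>
          let x := S ||| W
          let ℓ := lab.getD x 9
          if ℓ == 4 || ℓ == 0 then
            let c' := subCode n S D V W
            let g' : ℤ := g.getD c' 0
            if g' ≤ 0 then tc else
            if W == V then
              (if ℓ == 4 then (tc.1 + g', -g') else (tc.1, g'))
            else
              let y' : ℚ := y.getD c' 0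
              (if ℓ == 4 then (tc.1 + g' * (1 - y'), tc.2) else (tc.1 + g' * y', tc.2))
          else tc) (0, 0)
      let tot := acc.1
      let coef := acc.2
      if coef < 0 then
        -- core upper point: tot - gQ*y ≥ r  ⇒  y ≤ (tot - r)/gQ
        let ub : ℚ := (tot - rV) / gQ
        (LU.1, some (match LU.2 with | none => ub | some u => min u ub))
      else if coef > 0 then
        let lb : ℚ := (rV - tot) / gQ
        (some (match LU.1 with | none => lb | some l => max l lb), LU.2)
      else LU) (none, none)
  let lo : ℚ := max 0 (bounds.1.getD 0)
  let hi : ℚ := min 1 (bounds.2.getD 1)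
  if lo ≤ hi then (lo + hi) / 2 else lo

/-- **The recursive midpoint weights** `y(Q)` of all sub-cubes (array indexed by the base-3 code of `β_Q`), computed dimension by
dimension. [this work] -/
def recWeights (F : Sunflower (Fin n)) : Array ℚ :=
  let lab := labCode F
  let g := agBern F
  let r := rBern F
  let codes := List.range (3 ^ n)
  (List.range (n + 1)).foldl (fun (y : Array ℚ) d =>
    codes.foldl (fun (y : Array ℚ) c => if dim3 n c == d then y.set! c (recStep n lab g r y c) else y) y)
    (Array.replicate (3 ^ n) (0 : ℚ))

/-- Common denominator `N` and the MONOMIAL tables of `N·S` and `N·(AG − S)`, `S = Σ_β y_β g(β) x^β (1−x)^{2−β}`. [this work] -/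
def recTables (F : Sunflower (Fin n)) : ℕ × Array ℤ × Array ℤ :=
  let g := agBern F
  let y := recWeights F
  let N : ℕ := y.foldl (fun acc q => Nat.lcm acc q.den) 1
  let wA : Array ℤ := (Array.range (3 ^ n)).map fun c => (((N : ℚ) * y.getD c 0) * (g.getD c 0 : ℚ)).num
  let wB : Array ℤ := (Array.range (3 ^ n)).map fun c => (((N : ℚ) * (1 - y.getD c 0)) * (g.getD c 0 : ℚ)).num
  (N, backLA n 2 (List.finRange n) wA, backLA n 2 (List.finRange n) wB)

/-- **The data-free (C1) check by the recursive splitting**: the two Bernstein region certificates with `S₁ = N·S` (A-side) and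
`S₁' = N·(AG − S)` (B-side), `S₂ = 0`, scale `N`. [this work] -/
def checkRec (F : Sunflower (Fin n)) : Bool :=
  let t := recTables F
  certSide n (laArr F) (dArr F) t.1 t.2.1 (zeroArr n 1) && certSide n (lbArr F) (ndArr F) t.1 t.2.2 (zeroArr n 1)

/-- **(C1) from the recursive splitting check**: if `checkRec F` evaluates to `true` then `e₃(c) ≤ max(a,b)·(ab − e₂(c))` for the cell
masses of `F` at every bias `x ∈ [0,1]^n`. [this work] -/
theorem c1_of_checkRec (F : Sunflower (Fin n)) (h : checkRec F = true) (x : Fin n → ℝ) (hx : ∀ i, 0 ≤ x i ∧ x i ≤ 1) :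
    cellMass F 1 x * cellMass F 2 x * cellMass F 3 x ≤
      max (cellMass F 4 x) (cellMass F 0 x) *
        (cellMass F 4 x * cellMass F 0 x
          - (cellMass F 1 x * cellMass F 2 x + cellMass F 1 x * cellMass F 3 x + cellMass F 2 x * cellMass F 3 x)) := by
  simp only [checkRec, Bool.and_eq_true] at h
  exact c1_of_certs F h.1 h.2 x hx

/-- A successful recursive check exhibits a Gladkov splitting in the sense of …SunflowerC1SplittingStatement only when the weights are
`0/1`; in general it is a SANDWICH (`0 ≤ σ ≤ g`).  **The conjecture, as a `Prop`** (memo gen 34 §3; census-true on 6 276 structures, n ≤ 9;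
OPEN): the recursive midpoint rule certifies every three-petal sunflower of up-sets. [this work] -/
def RecursiveSplittingConjecture : Prop := ∀ (n : ℕ) (F : Sunflower (Fin n)), checkRec F = true

/-- The conjecture implies (C1) for every sunflower at every bias. [this work] -/
theorem c1_of_recursiveSplittingConjecture (h : RecursiveSplittingConjecture) {n : ℕ} (F : Sunflower (Fin n)) (x : Fin n → ℝ)
    (hx : ∀ i, 0 ≤ x i ∧ x i ≤ 1) :
    cellMass F 1 x * cellMass F 2 x * cellMass F 3 x ≤
      max (cellMass F 4 x) (cellMass F 0 x) *
        (cellMass F 4 x * cellMass F 0 x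
          - (cellMass F 1 x * cellMass F 2 x + cellMass F 1 x * cellMass F 3 x + cellMass F 2 x * cellMass F 3 x)) :=
  c1_of_checkRec F (h n F) x hx

end C1Cert

end SafeCalc

end Summit.CriticalPhenomena.PercolationContinuityZ3.Theorems.SunflowerPartition
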